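import Summits.NavierStokesRegularity.NavierStokesRegularity.Theses.LandauTail
import Summits.NavierStokesRegularity.NavierStokesRegularity.Theorems.LandauTailHomSteadyProfileExistsMomentum

/-!
# Route `LandauTail`: `HomSteadyProfileExists` (stmt-NavierStokesRegularity-1951) — PROVED

The typed profile class of route `LandauTail` ("`U, P` smooth on `ℝ³ ∖ {0}`,
`(U·∇)U + ∇P = 1 • ΔU` and `div U = 0` off the origin, `U(c x) = c⁻¹ U(x)` for all `c > 0` and
all `x`, `U ≠ 0`") is non-vacuous: Landau's solution with viscosity `1` and parameter `A = 2`,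
`U = landauSolution 1 2 = landauAxisField eZ 2`, `P = landauPressure 1 2 = landauAxisPressure eZ 2`
(Lemarié-Rieusset 2016, Thm 10.13, (10.44); Literature/Analysis/FluidPDE/LandauSolutions) is a
witness. Smoothness off the origin, `(−1)`-homogeneity (for all `x`, junk value `0` at the
origin) and non-triviality are the tree's `contDiffOn_landauSolution`, `contDiffOn_landauPressure`,
`landauSolution_smul`, `landauSolution_eZ_ne_zero`; the two PDE identities are Landau's theorem,
proved in the sibling helper files (`…Calculus`, `…Profile`, `…Momentum`:
`landauAxisField_momentum`, `divergence_landauAxisField`).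

References: L. D. Landau, Dokl. Akad. Nauk SSSR 43 (1944) 286–288; P. G. Lemarié-Rieusset,
*The Navier–Stokes problem in the 21st century* (2016), Thm 10.13 (10.44); V. Šverák, J. Math.
Sci. 179 (2011), Thm 1.
-/

noncomputable section

open scoped Laplacian InnerProductSpace RealInnerProductSpace
open Literature.Analysis.FluidPDE

-- the summit namespace `…NavierStokesRegularity.NavierStokesRegularity…` is the tree convention
set_option linter.dupNamespace false

namespace Summit.NavierStokesRegularity.NavierStokesRegularity.Theorems.LandauTail

/-- `|e₃| = 1`. [folklore] -/
theorem norm_eZ_eq_one' : ‖(eZ : EuclideanSpace ℝ (Fin 3))‖ = 1 := by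
  simp [eZ]

/-- **Settles stmt-NavierStokesRegularity-1951** (`LandauTail.HomSteadyProfileExists`): Landau's
solution `landauSolution 1 2` with pressure `landauPressure 1 2` is a nonzero, `(−1)`-homogeneous,
smooth-off-the-origin solution of the steady Navier–Stokes equations (viscosity `1`) on
`ℝ³ ∖ {0}` (Landau 1944; Lemarié-Rieusset 2016, Thm 10.13). [folklore] -/
theorem homSteadyProfileExists_proof :
    Summit.NavierStokesRegularity.NavierStokesRegularity.Theses.LandauTail.HomSteadyProfileExists := by
  unfold Summit.NavierStokesRegularity.NavierStokesRegularity.Theses.LandauTail.HomSteadyProfileExists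
  have hA : (1 : ℝ) < |(2 : ℝ)| := by norm_num
  refine ⟨landauSolution 1 2, landauPressure 1 2, contDiffOn_landauSolution hA,
    contDiffOn_landauPressure hA, fun x hx => ?_, fun x hx => ?_,
    fun c hc x => landauSolution_smul hc x, ⟨eZ, landauSolution_eZ_ne_zero one_ne_zero (by norm_num)⟩⟩
  · rw [one_smul, landauSolution_one, landauPressure_one]
    exact landauAxisField_momentum norm_eZ_eq_one' hA hx
  · rw [landauSolution_one]
    exact divergence_landauAxisField norm_eZ_eq_one' hA hx

end Summit.NavierStokesRegularity.NavierStokesRegularity.Theorems.LandauTail
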